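import Summits.NavierStokesRegularity.FluidComputer.PalasekTowerStageUniqueness
import Literature.Analysis.FluidPDE.ForcedSymmetryPreservation

/-!
# Registered stages and realisations inherit every isometry symmetry of the schedule's datum and force

Cell `ns-blowup`, seat `ns-blowup-lean` (g8); companion of `PalasekTowerStageUniqueness.lean` (one flow
per schedule) and of `Literature/Analysis/FluidPDE/ForcedSymmetryPreservation.lean` (symmetry
preservation for forced finite-energy classical solutions, Clay-class force). LABEL: E–C typing (KERNEL
bookkeeping; theorems only, no definition, no named fact, no hypothesis `hU` — Tao's forced
unconditional uniqueness is the tree's theorem `tao2011_forced_unconditionalUniqueness_velocity_schwartzForce_holds'`).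
WHAT THIS IS NOT: not Navier–Stokes evidence — nothing is constructed, asserted or refuted about any
crux; these are constraints every INHABITANT of the typed objects `Stage` / `Realisation` must satisfy.

## Why (tribunal T2 ∀-form supplement `t2-r3-forall-cap-supplement.md` 3eec0c4d45769a4d, DIRECTOR-NS relay 2026-08-26T10:42:01Z; planner g18 disposition STATUS l.3347; lean g7 OFFER)

The heredity binders `HeredityAtOne` / `HeredityFrom 2` (items 19249 / 19250) quantify over EVERY
pinned rigid quiet schedule and EVERY registered stage (`Margins.routeG` has no symmetry clause). A
Negative-lane lever against them in a «sterile» symmetry class 𝒮 (e.g. axisymmetric without swirl,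
where a printed all-time speed cap is available) needs, besides ONE registered 𝒮-stage, the fact that
the register cannot leave 𝒮: the stage's flow is THE unique forced continuation of the schedule's
datum (`Stage.velocity_eq_of_le`), and uniqueness transports symmetry. This module types exactly that:

* `Stage.conj_eq` — for a stage `s` of a schedule `S` at viscosity `ν > 0` and a linear isometry `R`
  of `ℝ³` fixing `S.u₀` and fixing `S.f t` for `t ∈ [0, τ_k]`: `R (s.u t (R⁻¹ x)) = s.u t x` on
  `[0, τ_k]`; `Stage.isAxisymmetric`, `Stage.hasNoSwirl` (rotations about the axis / the meridian
  reflection; `Stage.isAxisymmetric_of_schedule`, `Stage.hasNoSwirl_of_schedule` take the symmetry of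
  the force on all of `[0, ∞)`, where a schedule's force lives);
* `Realisation.conj_eq`, `Realisation.isAxisymmetric`, `Realisation.hasNoSwirl` — the same for the
  E–C endpoint object on `[0, T)` (finite energy on every closed sub-slab, `Realisation.energy`).

So a design class cut out by isometries of `ℝ³` (axisymmetric, axisymmetric without swirl, any finite
symmetry group) is HEREDITARY along the register: every registered stage of an 𝒮-schedule is an
𝒮-flow at every level, and any a-priori bound printed for 𝒮-flows of the forced system binds its
floors. Proof: `IsClassicalNSSolutionOn.conj_eq_of_clayForce` (conjugation covariance,
Majda–Bertozzi 2002, §1.2 Prop. 1.1 (iii), + Tao 2013, Cor. 11.4 WITH a Clay-class force) fed with the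
stage's fields `classical` / `initial` / `energy`, the schedule's `force_smooth` / `force_decay`, and
the `H¹` datum (`Theorems.ClayUniqueness.memLp_two_of_rapidDecay` of `datum_decay`).

References: A. J. Majda, A. L. Bertozzi, *Vorticity and Incompressible Flow*, CUP 2002, §1.2
Prop. 1.1 (iii), §2.3.3 (2.52)–(2.53) [cite: MajdaBertozziCUP2002, §2.3.3]; T. Tao, Anal. PDE 6 (2013),
Cor. 11.4 [cite: Tao2011, Cor. 11.4]; S. Palasek, arXiv:2605.13827 §3.3–§4
[cite: Palasek2026ElementaryModel, §4].
-/

noncomputable section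

namespace Summit.NavierStokesRegularity.FluidComputer.PalasekTowerClayBridge

open Set MeasureTheory Filter Topology Function
open scoped ENNReal ContDiff NNReal
open Literature.Analysis.FluidPDE
open Summit.NavierStokesRegularity.NavierStokesRegularity

/-! ## §1 Registered stages -/

namespace Stage

variable {ν : ℝ} {R : TowerRates} {S : Schedule R} {m : Margins R} {k : ℕ}

/-- The datum of a schedule carrying a stage is `H¹`: `u₀, ∇u₀ ∈ L²` (Clay decay (4) of `S.u₀` and
smoothness of the slice `t = 0`). [folklore] -/
theorem memLp_datum (s : Stage ν R S m k) :
    MemLp S.u₀ 2 volume ∧ MemLp (fderiv ℝ S.u₀) 2 volume :=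
  Theorems.ClayUniqueness.memLp_two_of_rapidDecay S.datum_decay
    (s.contDiff_datum.of_le (by norm_cast))

/-- **A registered stage inherits every isometry symmetry of the schedule's datum and force.** For a
stage `s` at level `k` of the schedule `S` at viscosity `ν > 0` and a linear isometry `R` of `ℝ³` with
`R (S.u₀ (R⁻¹ x)) = S.u₀ x` and `R (S.f t (R⁻¹ x)) = S.f t x` for `t ∈ [0, τ_k]`:
`R (s.u t (R⁻¹ x)) = s.u t x` for every `t ∈ [0, τ_k]` — the conjugate flow is a finite-energy
classical solution of the same forced system from the same Clay datum, and such solutions are unique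
(Tao 2013, Cor. 11.4 WITH a Clay-class force). [cite: MajdaBertozziCUP2002, §1.2 Prop. 1.1 (iii); Tao2011, Cor. 11.4] -/
theorem conj_eq (s : Stage ν R S m k) (hν : 0 < ν)
    (Rot : EuclideanSpace ℝ (Fin 3) ≃ₗᵢ[ℝ] EuclideanSpace ℝ (Fin 3))
    (h0 : ∀ x, Rot (S.u₀ (Rot.symm x)) = S.u₀ x)
    (hf : ∀ t ∈ Icc 0 (S.τ k), ∀ x, Rot (S.f t (Rot.symm x)) = S.f t x) :
    ∀ t ∈ Icc 0 (S.τ k), ∀ x, Rot (s.u t (Rot.symm x)) = s.u t x :=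
  s.classical.conj_eq_of_clayForce Rot hν (S.τ_pos k) s.memLp_datum.1 s.memLp_datum.2 S.force_smooth
    S.force_decay s.initial s.energy hf h0

/-- **Registered stages of axisymmetric schedules are axisymmetric**: if `S.u₀` is axisymmetric and
`S.f t` is axisymmetric for `t ∈ [0, τ_k]`, every stage of `S` at level `k` (viscosity `ν > 0`) has an
axisymmetric velocity at every `t ∈ [0, τ_k]` (Majda–Bertozzi 2002, §2.3.3, (2.52)–(2.53)).
[cite: MajdaBertozziCUP2002, §2.3.3 (2.52)–(2.53); Tao2011, Cor. 11.4] -/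
theorem isAxisymmetric (s : Stage ν R S m k) (hν : 0 < ν) (h0A : IsAxisymmetric S.u₀)
    (hfA : ∀ t ∈ Icc 0 (S.τ k), IsAxisymmetric (S.f t)) :
    ∀ t ∈ Icc 0 (S.τ k), IsAxisymmetric (s.u t) :=
  s.classical.isAxisymmetric_of_clayForce hν (S.τ_pos k) s.memLp_datum.1 s.memLp_datum.2
    S.force_smooth S.force_decay s.initial s.energy hfA h0A

/-- **Registered stages of axisymmetric swirl-free schedules are axisymmetric without swirl**: if
`S.u₀` and `S.f t` (`t ∈ [0, τ_k]`) are axisymmetric without swirl, every stage of `S` at level `k`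
(viscosity `ν > 0`) has a swirl-free velocity at every `t ∈ [0, τ_k]` (meridian reflection;
Lemarié-Rieusset 2016, (10.20)–(10.21)). [cite: LemarieRieusset2016, §10.3 (10.20)–(10.21), p. 284; Tao2011, Cor. 11.4] -/
theorem hasNoSwirl (s : Stage ν R S m k) (hν : 0 < ν) (h0A : IsAxisymmetric S.u₀)
    (h0S : HasNoSwirl S.u₀) (hfA : ∀ t ∈ Icc 0 (S.τ k), IsAxisymmetric (S.f t))
    (hfS : ∀ t ∈ Icc 0 (S.τ k), HasNoSwirl (S.f t)) :
    ∀ t ∈ Icc 0 (S.τ k), HasNoSwirl (s.u t) :=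
  s.classical.hasNoSwirl_of_clayForce hν (S.τ_pos k) s.memLp_datum.1 s.memLp_datum.2
    S.force_smooth S.force_decay s.initial s.energy hfA hfS h0A h0S

/-- Schedule form of `Stage.isAxisymmetric`: an axisymmetric datum and a force axisymmetric on all of
`[0, ∞)` (where a schedule's force is fixed in advance) give axisymmetric stages at EVERY level.
[cite: MajdaBertozziCUP2002, §2.3.3 (2.52)–(2.53)] -/
theorem isAxisymmetric_of_schedule (s : Stage ν R S m k) (hν : 0 < ν) (h0A : IsAxisymmetric S.u₀)
    (hfA : ∀ t, 0 ≤ t → IsAxisymmetric (S.f t)) :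
    ∀ t ∈ Icc 0 (S.τ k), IsAxisymmetric (s.u t) :=
  s.isAxisymmetric hν h0A fun t ht => hfA t ht.1

/-- Schedule form of `Stage.hasNoSwirl`: an axisymmetric swirl-free datum and a force axisymmetric
without swirl on all of `[0, ∞)` give axisymmetric swirl-free stages at EVERY level — the class
«axisymmetric without swirl» is hereditary along the register. [cite: LemarieRieusset2016, §10.3 (10.20)–(10.21), p. 284] -/
theorem hasNoSwirl_of_schedule (s : Stage ν R S m k) (hν : 0 < ν) (h0A : IsAxisymmetric S.u₀)
    (h0S : HasNoSwirl S.u₀) (hfA : ∀ t, 0 ≤ t → IsAxisymmetric (S.f t))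
    (hfS : ∀ t, 0 ≤ t → HasNoSwirl (S.f t)) :
    ∀ t ∈ Icc 0 (S.τ k), IsAxisymmetric (s.u t) ∧ HasNoSwirl (s.u t) :=
  fun t ht => ⟨s.isAxisymmetric hν h0A (fun r hr => hfA r hr.1) t ht,
    s.hasNoSwirl hν h0A h0S (fun r hr => hfA r hr.1) (fun r hr => hfS r hr.1) t ht⟩

end Stage

/-! ## §2 Realisations (the E–C endpoint object on `[0, T)`) -/

namespace Realisation

variable {ν : ℝ} {R : TowerRates}

/-- The datum of a realisation is `H¹`: `u 0, ∇(u 0) ∈ L²`. [folklore] -/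
theorem memLp_datum (W : Realisation ν R) :
    MemLp (W.u 0) 2 volume ∧ MemLp (fderiv ℝ (W.u 0)) 2 volume :=
  Theorems.ClayUniqueness.memLp_two_of_rapidDecay W.datum_decay
    (W.contDiff_datum.of_le (by norm_cast))

/-- A realisation restricted to a closed slab `[0, T']`, `0 < T' < T`, is a classical solution there.
[folklore] -/
theorem classical_Icc (W : Realisation ν R) {T' : ℝ} (hT'0 : 0 < T') (hT' : T' < W.T) :
    IsClassicalNSSolutionOn (Icc 0 T') ν W.f W.u W.p :=
  W.classical.mono (Icc_subset_Ico_right hT') (uniqueDiffOn_Icc hT'0)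

/-- **A realisation inherits every isometry symmetry of its datum and force** on `[0, T)`: for
`ν > 0` and a linear isometry `R` of `ℝ³` fixing `W.u 0` and fixing `W.f t` for `t ∈ [0, T)`,
`R (W.u t (R⁻¹ x)) = W.u t x` for every `t ∈ [0, T)` (apply the Clay-class symmetry preservation on
each closed sub-slab `[0, t]`, where the realisation has finite energy). [cite: MajdaBertozziCUP2002, §1.2 Prop. 1.1 (iii); Tao2011, Cor. 11.4] -/
theorem conj_eq (W : Realisation ν R) (hν : 0 < ν)
    (Rot : EuclideanSpace ℝ (Fin 3) ≃ₗᵢ[ℝ] EuclideanSpace ℝ (Fin 3))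
    (h0 : ∀ x, Rot (W.u 0 (Rot.symm x)) = W.u 0 x)
    (hf : ∀ t ∈ Ico 0 W.T, ∀ x, Rot (W.f t (Rot.symm x)) = W.f t x) :
    ∀ t ∈ Ico 0 W.T, ∀ x, Rot (W.u t (Rot.symm x)) = W.u t x := by
  intro t ht x
  rcases ht.1.eq_or_lt with h | h
  · rw [← h]
    exact h0 x
  · exact (W.classical_Icc h ht.2).conj_eq_of_clayForce Rot hν h W.memLp_datum.1 W.memLp_datum.2
      W.force_smooth W.force_decay rfl (W.energy t ht.2)
      (fun r hr y => hf r ⟨hr.1, hr.2.trans_lt ht.2⟩ y) h0 t ⟨h.le, le_rfl⟩ x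

/-- **Realisations from axisymmetric data under axisymmetric forces are axisymmetric** on `[0, T)`.
[cite: MajdaBertozziCUP2002, §2.3.3 (2.52)–(2.53); Tao2011, Cor. 11.4] -/
theorem isAxisymmetric (W : Realisation ν R) (hν : 0 < ν) (h0A : IsAxisymmetric (W.u 0))
    (hfA : ∀ t ∈ Ico 0 W.T, IsAxisymmetric (W.f t)) :
    ∀ t ∈ Ico 0 W.T, IsAxisymmetric (W.u t) := by
  intro t ht
  rw [isAxisymmetric_iff_conj_rotZLIE]
  intro θ x
  exact W.conj_eq hν (rotZLIE θ) ((isAxisymmetric_iff_conj_rotZLIE (W.u 0)).1 h0A θ)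
    (fun r hr y => (isAxisymmetric_iff_conj_rotZLIE (W.f r)).1 (hfA r hr) θ y) t ht x

/-- **Realisations from axisymmetric swirl-free data under axisymmetric swirl-free forces have no
swirl** on `[0, T)`. [cite: LemarieRieusset2016, §10.3 (10.20)–(10.21), p. 284; Tao2011, Cor. 11.4] -/
theorem hasNoSwirl (W : Realisation ν R) (hν : 0 < ν) (h0A : IsAxisymmetric (W.u 0))
    (h0S : HasNoSwirl (W.u 0)) (hfA : ∀ t ∈ Ico 0 W.T, IsAxisymmetric (W.f t))
    (hfS : ∀ t ∈ Ico 0 W.T, HasNoSwirl (W.f t)) :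
    ∀ t ∈ Ico 0 W.T, HasNoSwirl (W.u t) := by
  intro t ht
  exact (W.isAxisymmetric hν h0A hfA t ht).hasNoSwirl_of_conj_reflY_eq
    (W.conj_eq hν reflY (h0A.conj_reflY_eq h0S)
      (fun r hr y => (hfA r hr).conj_reflY_eq (hfS r hr) y) t ht)

end Realisation

end Summit.NavierStokesRegularity.FluidComputer.PalasekTowerClayBridge

end
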